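import Literature.Topology.FourManifolds.SPC4Handles
import Literature.Topology.FourManifolds.NiceMorseFunctions
import Literature.Topology.FourManifolds.MorseSingleMinimum
import Literature.Topology.FourManifolds.MorseExistence
import HarnessLib

/-!
# Proofs for `SPC4Handles.lean` (b): towards `Literature.Topology.FourManifolds.exists_isMorse_isSelfIndexing`

Topic `Literature/Topology/FourManifolds` (trunk FourManL, notion `kirby_calculus_handles`);
sibling proofs file of `SPC4Handles.lean`, conjunct (b) (the sibling `SPC4HandlesProofs.lean` serves conjunct (c)), for the fact item
`provefact-Literature.SPC4.exists_isMorse_isSelfIndexing`.  Everything here is **proved**.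

State of the DAG (see `NiceMorseFunctions.lean`, `MorseSingleMinimum.lean`,
`MorseExistence.lean`):

* **E** — existence of Morse functions on closed manifolds: `Literature.Topology.FourManifolds.exists_isMorse_holds`
  (`MorseExistence.lean`; Whitney embedding + almost every height function is Morse,
  Guillemin–Pollack 1974, Ch. 1 §7).  **Proved.**
* **K** — cancelling a superfluous minimum against a `1`-handle on a closed connected manifold
  (Matsumoto 2001, proof of Thm. 3.35; Milnor 1965, Thm. 8.1): the named fact
  `Literature.exists_isMorse_ncard_criticalSetOfIndex_zero_add_one_eq n`.  *Open* (needs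
  gradient-like flows, the regular interval theorem and the first cancellation theorem,
  Milnor 1965, Thm. 5.4).
* **R** — final rearrangement into a self-indexing Morse function with the same critical
  points and indices (Milnor 1965, Thm. 4.8): the named fact
  `Literature.exists_isSelfIndexing_criticalSet_eq n`.  *Open* (needs Milnor 1965, §4).
* **U** ⇐ E + K (`MorseSingleMinimum.lean`), **target** ⇐ R + U (`NiceMorseFunctions.lean`):
  **proved**; with E discharged here:
  `Literature.Topology.FourManifolds.exists_isMorse_ncard_criticalSetOfIndex_eq_one_of_cancel` (Matsumoto's Thm. 3.35 from
  the cancellation step alone) and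
  `Literature.Topology.FourManifolds.exists_isMorse_isSelfIndexing_of_cancel_of_rearrangement` (the target from K and
  R alone).

## References

* J. Milnor, *Lectures on the h-cobordism theorem* (1965), Thm. 4.8, Thm. 5.4, Thm. 8.1.
  [MilnorHCobordism1965]
* Y. Matsumoto, *An introduction to Morse theory* (2001), Thm. 2.20, Thm. 3.35. [Matsumoto2001]
* V. Guillemin, A. Pollack, *Differential topology* (1974), Ch. 1 §7. [GuilleminPollack2010]
-/

open scoped Manifold ContDiff
open Set Function

noncomputable section

namespace Literature.Topology.FourManifolds

universe u

variable (n : ℕ)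

/-- **Matsumoto's Theorem 3.35 from the cancellation step alone**: given the cancellation
step `Literature.exists_isMorse_ncard_criticalSetOfIndex_zero_add_one_eq n` (Matsumoto 2001, proof
of Thm. 3.35; Milnor 1965, Thm. 8.1), every closed connected `n`-manifold carries a Morse
function with exactly one critical point of index `0` and exactly one of index `n`; the
existence of some Morse function to start from is `Literature.Topology.FourManifolds.exists_isMorse_holds`. [cite: Matsumoto2001, Thm. 3.35] -/
theorem exists_isMorse_ncard_criticalSetOfIndex_eq_one_of_cancel
    (hK : exists_isMorse_ncard_criticalSetOfIndex_zero_add_one_eq.{u} n) :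
    exists_isMorse_ncard_criticalSetOfIndex_eq_one.{u} n :=
  exists_isMorse_ncard_criticalSetOfIndex_eq_one_of_facts n (FourManifolds.exists_isMorse_holds n) hK

/-- **The target fact from the two open named facts of Milnor's theory**: the cancellation
step K (Matsumoto 2001, proof of Thm. 3.35 / Milnor 1965, Thm. 8.1) and the final
rearrangement theorem R (Milnor 1965, Thm. 4.8) imply
`Literature.SPC4.exists_isMorse_isSelfIndexing n`; existence of Morse functions (E) is discharged by
`Literature.Topology.FourManifolds.exists_isMorse_holds`. [cite: MilnorHCobordism1965, Thm. 4.8 and §8] -/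
theorem exists_isMorse_isSelfIndexing_of_cancel_of_rearrangement
    (hK : exists_isMorse_ncard_criticalSetOfIndex_zero_add_one_eq.{u} n)
    (hR : exists_isSelfIndexing_criticalSet_eq.{u} n) :
    FourManifolds.exists_isMorse_isSelfIndexing.{u} n :=
  FourManifolds.exists_isMorse_isSelfIndexing_of_exists_of_cancel_of_rearrangement n
    (FourManifolds.exists_isMorse_holds n) hK hR

end Literature.Topology.FourManifolds
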